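import Mathlib
import Summits.Ventures.PercRepro2.SwOutMixedArmsClosureCube

/-!
# The several-arms big-block lemma under the geometric closure: the slice inequality (blind cell
PercRepro2, night-4 g21, 2026-08-27; proofs/NIGHT4-G21.md §2)

`slice_card_le`: on the slice `f = f₀` of the non-leaking block of a set closed under `ArmLower`
and `RaiseUP` (pure arms, a u-arm present), for every up-set `𝓔`,
`#{q : ER q ∈ 𝓔} ≤ #{q : EBT ∅ q ∈ 𝓔}` (the `f`-frozen blue set).  The proof of the module
docstring of SwOutMixedArmsClosureCube: the off-diagonal T-slab by the injection `phiOff`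
(`offdiag_step`), the points with a red u-arm and `uP = e` by the cube principle on the
down-closure `Mt` (`cube_step`, `diag_step`), the two target families disjoint (`targets_step`);
the slice where the bottom point's red set lies in `𝓔` is trivial.
-/

namespace Summit.Ventures.PercRepro2

namespace MixedArms

open scoped Classical

variable {ι ρ ν κ : Type*}

section Slice

variable [IsEmpty ν] [Nonempty ι] [Fintype ι] [DecidableEq ι] [Fintype ρ] [DecidableEq ρ]
  [Fintype ν] [DecidableEq ν] [Fintype κ] [DecidableEq κ] {arm : ν → ρ} {Q : Set (PtR ι ρ ν κ)}

omit [Nonempty ι] [Fintype ν] [DecidableEq ν] [Fintype κ] [DecidableEq κ] in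
/-- **The cube principle on the down-closure**: the count of cube points with red set in `𝓔` is at
most the count with the red set of the flipped point in `𝓔` (Harris twice and the flip). -/
lemma cube_step (f₀ : Config κ) {𝓔 : Set (Set (AtomR ι ρ ν κ))} (h𝓔 : IsUpperSet 𝓔) :
    N (fun x : Config (ι ⊕ ρ) => x ∈ Mt Q arm f₀ ∧ ER (toPt f₀ x : PtR ι ρ ν κ) ∈ 𝓔) ≤
      N (fun x : Config (ι ⊕ ρ) =>
        x ∈ Mt Q arm f₀ ∧ ER (toPt f₀ (flipAll x) : PtR ι ρ ν κ) ∈ 𝓔) := by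
  have hA : IsUpperSet {x : Config (ι ⊕ ρ) | ER (toPt f₀ x : PtR ι ρ ν κ) ∈ 𝓔} := by
    intro x y hle hx
    exact h𝓔 (ER_mono (toPt_mono f₀ hle)) hx
  have hB : IsLowerSet {x : Config (ι ⊕ ρ) | ER (toPt f₀ (flipAll x) : PtR ι ρ ν κ) ∈ 𝓔} := by
    intro x y hle hx
    exact h𝓔 (ER_mono (toPt_mono f₀ (MixedCube.flipAll_le_flipAll' hle))) hx
  have hAB : flipAll ⁻¹' {x : Config (ι ⊕ ρ) | ER (toPt f₀ (flipAll x) : PtR ι ρ ν κ) ∈ 𝓔} =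
      {x : Config (ι ⊕ ρ) | ER (toPt f₀ x : PtR ι ρ ν κ) ∈ 𝓔} := by
    ext x
    simp only [Set.mem_preimage, Set.mem_setOf_eq, flipAll_involutive x]
  have key := LocRows.card_inter_le_of_cube (isLowerSet_Mt (Q := Q) (arm := arm) f₀) hA hB hAB
  have e1 : N (fun x : Config (ι ⊕ ρ) => x ∈ Mt Q arm f₀ ∧ ER (toPt f₀ x : PtR ι ρ ν κ) ∈ 𝓔) =
      (Finset.univ.filter (· ∈ Mt Q arm f₀ ∩
        {x : Config (ι ⊕ ρ) | ER (toPt f₀ x : PtR ι ρ ν κ) ∈ 𝓔})).card := by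
    unfold N
    congr 1
    ext x
    simp only [Finset.mem_filter, Finset.mem_univ, true_and, Set.mem_inter_iff, Set.mem_setOf_eq]
  have e2 : N (fun x : Config (ι ⊕ ρ) =>
        x ∈ Mt Q arm f₀ ∧ ER (toPt f₀ (flipAll x) : PtR ι ρ ν κ) ∈ 𝓔) =
      (Finset.univ.filter (· ∈ Mt Q arm f₀ ∩
        {x : Config (ι ⊕ ρ) | ER (toPt f₀ (flipAll x) : PtR ι ρ ν κ) ∈ 𝓔})).card := by
    unfold N
    congr 1
    ext x
    simp only [Finset.mem_filter, Finset.mem_univ, true_and, Set.mem_inter_iff, Set.mem_setOf_eq]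
  rw [e1, e2]
  exact key

/-- **The off-diagonal step**: the off-diagonal T-slab points with a red u-arm inject into the
B-slab points with `e ≠ ⊥`, carrying `ER` to `EBT ∅`. -/
lemma offdiag_step (hL : ArmLower arm Q) (hR : RaiseUP arm Q) (f₀ : Config κ)
    (𝓔 : Set (Set (AtomR ι ρ ν κ))) :
    N (fun q : PtR ι ρ ν κ => ((q ∈ Q ∧ ¬ Leak q arm ∧ q.2.2.2.2 = f₀ ∧ ER q ∈ 𝓔) ∧
        ∃ j, q.1 j = true) ∧ ¬ q.2.2.1 = q.2.2.2.1) ≤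
      N (fun q : PtR ι ρ ν κ => (q ∈ Q ∧ ¬ Leak q arm ∧ q.2.2.2.2 = f₀ ∧ EBT ∅ q ∈ 𝓔) ∧
        (∀ j, q.1 j = false) ∧ q.2.2.2.1 ≠ fun _ => false) := by
  refine N_le_of_inj phiOff (fun q hq => ?_) (fun q q' hq hq' hqq' => ?_)
  · obtain ⟨⟨⟨hQ, hL', hf, hE⟩, hs⟩, hne⟩ := hq
    have hT := top_of_red_of_ne hL' hs hne
    obtain ⟨hm, hmL⟩ := phiOff_mem hL hR hQ hL' hT
    refine ⟨⟨hm, hmL, hf, ?_⟩, phiOff_bot q, phiOff_e_ne_bot hL' hT hne⟩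
    rw [EBT_phiOff hT]
    exact hE
  · obtain ⟨⟨⟨-, hL', -, -⟩, hs⟩, hne⟩ := hq
    obtain ⟨⟨⟨-, hL'', -, -⟩, hs'⟩, hne'⟩ := hq'
    exact phiOff_inj hL' hL'' (top_of_red_of_ne hL' hs hne) (top_of_red_of_ne hL'' hs' hne') hqq'

/-- **The diagonal step**: the points with a red u-arm and `uP = e` are counted, through the cube
principle on the down-closure, by the mixed points and the B-slab points with `e = ⊥`. -/
lemma diag_step (hL : ArmLower arm Q) (hR : RaiseUP arm Q) (f₀ : Config κ)
    {𝓔 : Set (Set (AtomR ι ρ ν κ))} (h𝓔 : IsUpperSet 𝓔)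
    (h0 : ER (botF f₀ : PtR ι ρ ν κ) ∉ 𝓔) :
    N (fun q : PtR ι ρ ν κ => ((q ∈ Q ∧ ¬ Leak q arm ∧ q.2.2.2.2 = f₀ ∧ ER q ∈ 𝓔) ∧
        ∃ j, q.1 j = true) ∧ q.2.2.1 = q.2.2.2.1) ≤
      N (fun q : PtR ι ρ ν κ => (q ∈ Q ∧ ¬ Leak q arm ∧ q.2.2.2.2 = f₀ ∧ EBT ∅ q ∈ 𝓔) ∧
        (((∃ j, q.1 j = true) ∧ (∃ j, q.1 j = false) ∧ q.2.2.1 = q.2.2.2.1) ∨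
          ((∀ j, q.1 j = false) ∧ q.2.2.2.1 = fun _ => false))) := by
  refine le_trans ?_ (le_trans (cube_step (Q := Q) (arm := arm) f₀ h𝓔) ?_)
  · -- into the cube
    refine N_le_of_inj projCube (fun q hq => ?_) (fun q q' hq hq' hqq' => ?_)
    · obtain ⟨⟨⟨hQ, hL', hf, hE⟩, hs⟩, hd⟩ := hq
      refine ⟨⟨q, hQ, hL', hs, hf, le_rfl⟩, ?_⟩
      rw [toPt_projCube hd hf]
      exact hE
    · obtain ⟨⟨⟨-, -, hf, -⟩, -⟩, hd⟩ := hq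
      obtain ⟨⟨⟨-, -, hf', -⟩, -⟩, hd'⟩ := hq'
      rw [← toPt_projCube hd hf, ← toPt_projCube hd' hf', hqq']
  · -- out of the cube
    refine N_le_of_inj (realize f₀) (fun x hx => ?_) (fun x x' _ _ hxx' => ?_)
    · obtain ⟨hM, hE⟩ := hx
      have hs' : ∃ j, xs x j = false := by
        by_contra hc
        have hc' : ∀ j, xs x j = true := fun j => by simpa using not_exists.1 hc j
        apply h0
        have hnr : ¬ ∃ j, (toPt f₀ (flipAll x) : PtR ι ρ ν κ).1 j = true := by
          rintro ⟨j, hj⟩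
          have := hc' j
          simp only [toPt, xs, flipAll] at hj this
          rw [this] at hj
          exact absurd hj (by decide)
        rw [ER_eq_botF_of_not_red hnr] at hE
        exact hE
      obtain ⟨hm, hmL⟩ := realize_mem hL hR hM hs'
      refine ⟨⟨hm, hmL, ?_, ?_⟩, realize_kind f₀ hs'⟩
      · unfold realize
        split_ifs <;> rfl
      · rw [EBT_realize]
        exact hE
    · rw [← projCube_realize (ν := ν) f₀ x, ← projCube_realize (ν := ν) f₀ x', hxx']

omit [IsEmpty ν] [Nonempty ι] in
/-- **The targets are disjoint**: the B-slab points with `e ≠ ⊥` and the family of mixed points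
with `uP = e` or B-slab points with `e = ⊥` are disjoint subfamilies of the right-hand count. -/
lemma targets_step (f₀ : Config κ) (𝓔 : Set (Set (AtomR ι ρ ν κ))) :
    N (fun q : PtR ι ρ ν κ => (q ∈ Q ∧ ¬ Leak q arm ∧ q.2.2.2.2 = f₀ ∧ EBT ∅ q ∈ 𝓔) ∧
        (∀ j, q.1 j = false) ∧ q.2.2.2.1 ≠ fun _ => false) +
      N (fun q : PtR ι ρ ν κ => (q ∈ Q ∧ ¬ Leak q arm ∧ q.2.2.2.2 = f₀ ∧ EBT ∅ q ∈ 𝓔) ∧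
        (((∃ j, q.1 j = true) ∧ (∃ j, q.1 j = false) ∧ q.2.2.1 = q.2.2.2.1) ∨
          ((∀ j, q.1 j = false) ∧ q.2.2.2.1 = fun _ => false))) ≤
      N (fun q : PtR ι ρ ν κ => q ∈ Q ∧ ¬ Leak q arm ∧ q.2.2.2.2 = f₀ ∧ EBT ∅ q ∈ 𝓔) := by
  rw [N_split_pred (fun q : PtR ι ρ ν κ => q ∈ Q ∧ ¬ Leak q arm ∧ q.2.2.2.2 = f₀ ∧ EBT ∅ q ∈ 𝓔)
    (fun q => (∀ j, q.1 j = false) ∧ q.2.2.2.1 ≠ fun _ => false)]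
  refine Nat.add_le_add le_rfl (N_mono fun q hq => ⟨hq.1, ?_⟩)
  rcases hq.2 with ⟨hr, -, -⟩ | ⟨-, he⟩
  · rintro ⟨hb, -⟩
    obtain ⟨j, hj⟩ := hr
    rw [hb j] at hj
    exact absurd hj Bool.false_ne_true
  · rintro ⟨-, hne⟩
    exact hne he

/-- **The slice inequality**: on the slice `f = f₀`, the count of non-leaking points of `Q` with
red set in `𝓔` is at most the count with `f`-frozen blue set in `𝓔`. -/
theorem slice_card_le (hL : ArmLower arm Q) (hR : RaiseUP arm Q)
    {𝓔 : Set (Set (AtomR ι ρ ν κ))} (h𝓔 : IsUpperSet 𝓔) (f₀ : Config κ) :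
    N (fun q : PtR ι ρ ν κ => q ∈ Q ∧ ¬ Leak q arm ∧ q.2.2.2.2 = f₀ ∧ ER q ∈ 𝓔) ≤
      N (fun q : PtR ι ρ ν κ => q ∈ Q ∧ ¬ Leak q arm ∧ q.2.2.2.2 = f₀ ∧ EBT ∅ q ∈ 𝓔) := by
  by_cases h0 : ER (botF f₀ : PtR ι ρ ν κ) ∈ 𝓔
  · -- the trivial slice: every point of the slice counts on both sides
    calc N (fun q : PtR ι ρ ν κ => q ∈ Q ∧ ¬ Leak q arm ∧ q.2.2.2.2 = f₀ ∧ ER q ∈ 𝓔)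
        ≤ N (fun q : PtR ι ρ ν κ => q ∈ Q ∧ ¬ Leak q arm ∧ q.2.2.2.2 = f₀) :=
          N_mono fun q h => ⟨h.1, h.2.1, h.2.2.1⟩
      _ ≤ N (fun q : PtR ι ρ ν κ => q ∈ Q ∧ ¬ Leak q arm ∧ q.2.2.2.2 = f₀ ∧ EBT ∅ q ∈ 𝓔) :=
          N_mono fun q h => ⟨h.1, h.2.1, h.2.2, h𝓔 (by rw [← h.2.2]; exact ER_botF_subset_EBT q) h0⟩
  · -- the points counted on the left have a red u-arm
    have e1 : N (fun q : PtR ι ρ ν κ => q ∈ Q ∧ ¬ Leak q arm ∧ q.2.2.2.2 = f₀ ∧ ER q ∈ 𝓔) =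
        N (fun q : PtR ι ρ ν κ => (q ∈ Q ∧ ¬ Leak q arm ∧ q.2.2.2.2 = f₀ ∧ ER q ∈ 𝓔) ∧
          ∃ j, q.1 j = true) := by
      apply N_congr
      intro q
      refine ⟨fun h => ⟨h, ?_⟩, fun h => h.1⟩
      by_contra hc
      apply h0
      rw [← h.2.2.1, ← ER_eq_botF_of_not_red hc]
      exact h.2.2.2
    rw [e1, N_split_pred _ (fun q : PtR ι ρ ν κ => q.2.2.1 = q.2.2.2.1)]
    calc _ ≤ _ := Nat.add_le_add (diag_step hL hR f₀ h𝓔 h0) (offdiag_step hL hR f₀ 𝓔)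
      _ ≤ _ := by
          rw [Nat.add_comm]
          exact targets_step f₀ 𝓔

end Slice

end MixedArms

end Summit.Ventures.PercRepro2
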